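import Literature.NumberTheory.EllipticCurves.LocalTorsionCohomologyCoprime
import Literature.NumberTheory.EllipticCurves.JZeroKolyvaginPrimes
import Literature.NumberTheory.EllipticCurves.HuShuYin2019.SylvesterTowerTwoTorsion
import Literature.NumberTheory.NumberFields.AdicCompletionSquareCriteria
import HarnessLib

/-!
# The Sylvester pair `(E_{3p²}, E_p)` over `K = ℚ(ω)` at the additive places `v ∣ 3p`:
# no `K_v`-rational `2`-torsion, hence EMPTY local conditions for `H¹(K, X_K[2^M])`

Topic `NumberTheory/EllipticCurves/HuShuYin2019`; namespace
`Literature.NumberTheory.EllipticCurves.HuShuYin2019` (generic valuation lemmas in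
`Literature.NumberTheory.EllipticCurves`). Theorems only: **no definition, no named fact** (D-0026).

Setting: `K` a number field with `ω ∈ K`, `ω² + ω + 1 = 0`, `[K : ℚ] = 2` (the route binder of crux
`UpperOffV0HSYPlus`, stmt-BirchSwinnertonDyer-19804: `K = ℚ(ω)`, `d_K = −3`); `p ≠ 2, 3` a prime (the
route has `p ≡ 4, 7 (mod 9)`); the Hu–Shu–Yin pair `B = E_p : y² = x³ − 432p²` (`cubeSumCurve p`) and
`A = E_{3p²} : y² = x³ − 432·9p⁴` (`cubeSumCurve (3p²)`).  A `K_v`-rational point of order `2` on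
`y² = x³ − 432n²` is `(6θ, 0)` with `θ³ = 2n²` (tree `cubeSumCurve_eq_zero_of_two_pow_smul_eq_zero`), so
`X(K_v)[2] = 0` as soon as `2n²` is not a cube in `K_v`:

* §1 (any number field `K`): `ord_v(ℓᵃ·d') = e(v|ℓ)·a` (`intValuation_intCast_prime_pow_mul`,
  `valued_intCast_prime_pow_mul_adicCompletion`; general-`e` form of the tree's
  `valuation_intCast_of_ramificationIdx_eq_one`) and «no cube root in `K_v` when `3 ∤ e(v|ℓ)·a`»
  (`pow_three_ne_intCast_adicCompletion_of_not_dvd`, `pow_ne_algebraMap_adicCompletion_of_not_dvd_log_valuation`);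
* §2 (`K = ℚ(ω)`): `e(v|p) = 1` for `p ≠ 3` (`JZero.ramificationIdx_eq_one_of_prime_ne_three`, from
  `d_K = −3`), `e(v|3) = 2` and `ord_v(1 − ω) = 1` (`JZero.ramificationIdx_eq_two_and_valuation_one_sub_omega`,
  from `(1 − ω)² = −3ω` and `e ≤ [K : ℚ]`), and the cube-root obstruction at the ramified place
  (`JZero.pow_three_ne_intCast_adicCompletion_of_three_dvd_sub_one`): an integer `c` with `3 ∥ (c − 1)`
  is not a cube in `K_v`, `v ∣ 3`, because `(y − 1)(y − ω)(y − ω²) = y³ − 1` would have `ord_v = 2` while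
  each factor is a unit (if `ord_v(y − 1) = 0`) or each has `ord_v ≥ 1` (if `ord_v(y − 1) ≥ 1`);
  §2b: `3` is TOTALLY ramified — **`(3) = v²` and `(9) = v⁴`** as ideals of `𝓞_K` for the place `v ∋ 3`
  (`JZero.span_three_eq_asIdeal_sq`, `JZero.span_nine_eq_asIdeal_pow_four`: `e(v|3) = 2` gives `(3) ⊆ v²`, and
  `N(3) = 9` leaves no room for a cofactor) — the shape `Ideal.span {(9 : 𝓞 K)} = v.asIdeal ^ 4` consumed by the
  ramified-prime ring class theorems (`RingClassField.…_of_span_eq_pow`, `RingClassFieldInertiaGenerator` §5: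
  the primes of `K[m]` above `(1 − ω)` are totally ramified in `K[9m]`, `3 ∤ m`);
* §3: at `v ∣ p`: `ord_v(2p²) = 2`, `ord_v(18p⁴) = 4`, neither divisible by `3`
  (`pow_three_ne_two_mul_sq_adicCompletion_of_mem`, `pow_three_ne_two_mul_sq_three_mul_sq_adicCompletion_of_mem`);
  at `v ∣ 3`: `ord_v(18p⁴) = 4` for `A` (`…three_mul_sq_adicCompletion_of_three_mem`), and for `B` with
  `p ≡ 4 (mod 9)` the unit `c = −2p²` has `3 ∥ (c − 1)` (`pow_three_ne_two_mul_sq_adicCompletion_of_three_mem`).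
  (For `p ≡ 7 (mod 9)`, `2p²` IS a cube in `ℚ₃ ⊂ K_v` and `B(K_v)[2] ≠ 0`: the place `3` is then genuinely
  different — cell memo two §67 — and nothing is claimed here about it.)

Consequences (`§4`), via the tree's unconditional local count
`LocalTorsionCohomologyCoprime.lean` (`#H¹(K_v, X[n]) = #X(K_v)[n]²` at `v ∤ n`): at every place
`v ∣ p`, and at the place `v ∣ 3` (for `A` always, for `B` when `p ≡ 4 (9)`), **every class of
`H¹(K, X_K[2^k])` satisfies both the Selmer local condition (`selmerLocalKer`) and the strict local
condition (`torsionLocalKer`) at `v`** (`mem_localKers_cubeSumCurve_prime_of_mem`,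
`…_three_mul_sq_of_mem`, `…_three_mul_sq_of_three_mem`, `…_prime_of_three_mem`) — the conjuncts «`cA ℓ ∈ selmerLocalKer (A.baseChange K)
(v.adicCompletion K) 2`» / «`cB (ℓℓ′) ∈ …`» of leaf (L1) of
`Summits/…/Theorems/SylvesterTwoHeegnerIndexCoupledDescentAtTwo` at the additive places, for ANY
classes (cell memo MEMO-bsd-cm-two §57.1 (F3), §57.3 «at `v ∣ 3` and `v ∣ p` NOTHING to check»).
Nothing here claims BSD or any statement about Selmer groups beyond these local memberships.

## References

* [HuShuYin2019] Y. Hu, J. Shu, H. Yin, *An explicit Gross–Zagier formula related to the Sylvester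
  conjecture*, Trans. AMS 372 (2019), §2 (the curves `E_n : x³ + y³ = n ↔ y² = x³ − 432n²`).
* [SilvermanTate2015] J. H. Silverman, J. Tate, *Rational Points on Elliptic Curves*, 2nd ed., §2.1
  Thm. 2.1(a) (points of order two).
* [NeukirchANT1999] J. Neukirch, *Algebraic Number Theory* (1999), Ch. I §8 (ramification index,
  fundamental identity), Ch. II §4–§5 (valuations of completions).
* [MilneADT2006] J. S. Milne, *Arithmetic Duality Theorems*, 2nd ed. (2006), Ch. I Thm. 2.8, Cor. 2.3.
-/

noncomputable section

open scoped Classical NumberField Valued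

open NumberField IsDedekindDomain WeierstrassCurve

namespace Literature.NumberTheory.EllipticCurves

open Literature.NumberTheory.NumberFields Literature.NumberTheory.GaloisRepresentations

/-! ## §1 Valuations in `K_v`: no `k`-th root when `k ∤ ord_v` -/

section Valuation

variable {K : Type*} [Field K] [NumberField K] (v : HeightOneSpectrum (𝓞 K))

/-- **An element whose `v`-adic order is not divisible by `k` has no `k`-th root in `K_v`**
(`ord_v(t^k) = k · ord_v(t)`; Neukirch II §4). [cite: NeukirchANT1999, Ch. II §4 (discrete valuations of completions)] -/
theorem pow_ne_algebraMap_adicCompletion_of_not_dvd_log_valuation {x : K} {k : ℕ}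
    (hk : ¬ (k : ℤ) ∣ WithZero.log (v.valuation K x)) (t : v.adicCompletion K) :
    t ^ k ≠ algebraMap K (v.adicCompletion K) x := by
  intro ht
  apply hk
  rw [← HeightOneSpectrum.valuedAdicCompletion_eq_valuation' v x]
  change (k : ℤ) ∣ WithZero.log (Valued.v (algebraMap K (v.adicCompletion K) x))
  rw [← ht, map_pow, WithZero.log_pow, nsmul_eq_mul]
  exact dvd_mul_right _ _

/-- **`ord_v(ℓᵃ · d') = e(v | ℓ) · a`** for a prime `ℓ`, a place `v ∋ ℓ` with ramification index
`e(v | ℓ) = v.asIdeal.ramificationIdx ℤ`, and `ℓ ∤ d'` (Mathlib's `intValuation_liesOver`: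
`ord_v = e(v|ℓ) · ord_ℓ` on integers; the case `e = 1` is the tree's
`valuation_intCast_of_ramificationIdx_eq_one`). [cite: NeukirchANT1999, Ch. I §8, (8.1)–(8.2)] -/
theorem intValuation_intCast_prime_pow_mul {ℓ : ℕ} (hℓ : ℓ.Prime) (hℓv : ((ℓ : ℕ) : 𝓞 K) ∈ v.asIdeal)
    (a : ℕ) {d' : ℤ} (hd' : ¬ (ℓ : ℤ) ∣ d') :
    v.intValuation ((((ℓ : ℤ) ^ a * d' : ℤ)) : 𝓞 K) =
      WithZero.exp (-((v.asIdeal.ramificationIdx ℤ * a : ℕ) : ℤ)) := by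
  have hℓ0 : (ℓ : ℤ) ≠ 0 := by exact_mod_cast hℓ.ne_zero
  have hprime : (Ideal.span {(ℓ : ℤ)}).IsPrime :=
    (Ideal.span_singleton_prime hℓ0).mpr (Nat.prime_iff_prime_int.mp hℓ)
  have hbot : Ideal.span {(ℓ : ℤ)} ≠ ⊥ := by
    rw [ne_eq, Ideal.span_singleton_eq_bot]
    exact hℓ0
  set u : HeightOneSpectrum ℤ := ⟨Ideal.span {(ℓ : ℤ)}, hprime, hbot⟩ with hu
  haveI hlo : v.asIdeal.LiesOver u.asIdeal := liesOver_span_of_natCast_mem_asIdeal hℓ v hℓv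
  have he' : u.asIdeal.ramificationIdx' v.asIdeal = v.asIdeal.ramificationIdx ℤ :=
    Ideal.ramificationIdx'_eq_ramificationIdx u.asIdeal v.asIdeal hbot
  have hud : u.intValuation ((ℓ : ℤ) ^ a * d') = WithZero.exp (-(a : ℤ)) := by
    rw [map_mul, map_pow, HeightOneSpectrum.intValuation_singleton (v := u) hℓ0 rfl,
      HeightOneSpectrum.intValuation_eq_one_iff.2 (by rwa [hu, Ideal.mem_span_singleton]), mul_one,
      ← WithZero.exp_nsmul, nsmul_eq_mul, mul_neg, mul_one]
  have h := HeightOneSpectrum.intValuation_liesOver u v ((ℓ : ℤ) ^ a * d')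
  rw [he', hud, ← WithZero.exp_nsmul, nsmul_eq_mul] at h
  rw [← map_intCast (algebraMap ℤ (𝓞 K)), Int.cast_id, ← h]
  congr 1
  push_cast
  ring

/-- `K_v`-form: **`|ℓᵃ · d'|_v = exp(−e(v|ℓ) · a)`** for the valuation of the completion `K_v`
(`valued_intCast_adicCompletion`). [cite: NeukirchANT1999, Ch. II §4 (the valuation of the completion)] -/
theorem valued_intCast_prime_pow_mul_adicCompletion {ℓ : ℕ} (hℓ : ℓ.Prime)
    (hℓv : ((ℓ : ℕ) : 𝓞 K) ∈ v.asIdeal) (a : ℕ) {d' : ℤ} (hd' : ¬ (ℓ : ℤ) ∣ d') :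
    Valued.v ((((ℓ : ℤ) ^ a * d' : ℤ)) : v.adicCompletion K) =
      WithZero.exp (-((v.asIdeal.ramificationIdx ℤ * a : ℕ) : ℤ)) := by
  rw [valued_intCast_adicCompletion, intValuation_intCast_prime_pow_mul v hℓ hℓv a hd']

/-- **No cube root of `ℓᵃ · d'` in `K_v` when `3 ∤ e(v|ℓ) · a`** (`ℓ ∤ d'`).
[cite: NeukirchANT1999, Ch. II §4 (discrete valuations of completions)] -/
theorem pow_three_ne_intCast_adicCompletion_of_not_dvd {ℓ : ℕ} (hℓ : ℓ.Prime)
    (hℓv : ((ℓ : ℕ) : 𝓞 K) ∈ v.asIdeal) {a : ℕ} (ha : ¬ 3 ∣ v.asIdeal.ramificationIdx ℤ * a)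
    {d' : ℤ} (hd' : ¬ (ℓ : ℤ) ∣ d') (t : v.adicCompletion K) :
    t ^ 3 ≠ (((ℓ : ℤ) ^ a * d' : ℤ) : v.adicCompletion K) := by
  intro ht
  apply ha
  have h := valued_intCast_prime_pow_mul_adicCompletion v hℓ hℓv a hd'
  rw [← ht, map_pow] at h
  have hlog := congrArg WithZero.log h
  rw [WithZero.log_pow, WithZero.log_exp, nsmul_eq_mul] at hlog
  have h3 : (3 : ℤ) ∣ ((v.asIdeal.ramificationIdx ℤ * a : ℕ) : ℤ) :=
    ⟨-WithZero.log (Valued.v t), by push_cast at hlog ⊢; linarith⟩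
  exact_mod_cast h3

end Valuation

/-! ## §2 The CM field `K = ℚ(ω)`: `e(v | p) = 1` for `p ≠ 3`, `e(v | 3) = 2`, `ord_v(1 − ω) = 1` -/

section OmegaField

variable {K : Type} [Field K] [NumberField K] {ω : K}

/-- In `K = ℚ(ω)` (`ω² + ω + 1 = 0`, `[K : ℚ] = 2`, so `d_K = −3`) a prime `p ≠ 3` is UNRAMIFIED:
`e(v | p) = 1` for every place `v ∋ p` (Dedekind: `p ∤ d_K`; tree
`JZero.discr_eq_neg_three_of_sq_add_self_add_one`, Mathlib `NumberField.not_dvd_discr_iff_forall_mem`).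
[cite: NeukirchANT1999, Ch. III §2, Cor. (2.12) (p ramified ↔ p ∣ d_K)] -/
theorem JZero.ramificationIdx_eq_one_of_prime_ne_three (hω : ω ^ 2 + ω + 1 = 0)
    (h2 : Module.finrank ℚ K = 2) {p : ℕ} (hp : p.Prime) (hp3 : p ≠ 3)
    (v : HeightOneSpectrum (𝓞 K)) (hpv : ((p : ℕ) : 𝓞 K) ∈ v.asIdeal) :
    v.asIdeal.ramificationIdx ℤ = 1 := by
  have hpZ : Prime (p : ℤ) := Nat.prime_iff_prime_int.mp hp
  have hdisc : ¬ (p : ℤ) ∣ NumberField.discr K := by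
    rw [JZero.discr_eq_neg_three_of_sq_add_self_add_one hω h2, dvd_neg]
    intro h
    have h3 : (p : ℤ) ∣ ((3 : ℕ) : ℤ) := by exact_mod_cast h
    rw [Int.natCast_dvd_natCast, Nat.dvd_prime Nat.prime_three] at h3
    rcases h3 with h1 | h3
    · exact hp.one_lt.ne' h1
    · exact hp3 h3
  haveI : Algebra.IsUnramifiedAt ℤ v.asIdeal :=
    (NumberField.not_dvd_discr_iff_forall_mem K (𝓞 K) hpZ).mp hdisc v.asIdeal inferInstance
      (by exact_mod_cast hpv)
  exact Ideal.ramificationIdx_eq_one_of_isUnramifiedAt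

/-- `ω` is a `v`-adic unit at every finite place (`ω³ = 1`). [folklore] -/
private theorem JZero.valuation_omega_eq_one (hω : ω ^ 2 + ω + 1 = 0) (v : HeightOneSpectrum (𝓞 K)) :
    v.valuation K ω = 1 := by
  have h3 : ω ^ 3 = 1 := by linear_combination (ω - 1) * hω
  have h := congrArg (v.valuation K) h3
  rw [map_pow, map_one] at h
  exact (pow_eq_one_iff.mp h).resolve_right (by norm_num)

/-- In `K = ℚ(ω)` the place above `3` is (totally) RAMIFIED: **`e(v | 3) = 2`** and
**`ord_v(1 − ω) = 1`**, i.e. `v(1 − ω) = exp(−1)`, for every place `v ∋ 3`.  Proof: `(1 − ω)² = −3ω`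
gives `v(1−ω)² = v(3) = exp(−e)` with `e = e(v|3) ≤ [K : ℚ] = 2` (Mathlib `Ideal.ramificationIdx_le_finrank`),
so `e` is even and positive, `e = 2`. [cite: NeukirchANT1999, Ch. I §10 (ramification in ℚ(ζ_n): the prime 3 = −ω²(1−ω)² is totally ramified in ℚ(ζ₃))] -/
theorem JZero.ramificationIdx_eq_two_and_valuation_one_sub_omega (hω : ω ^ 2 + ω + 1 = 0)
    (h2 : Module.finrank ℚ K = 2) (v : HeightOneSpectrum (𝓞 K)) (h3v : ((3 : ℕ) : 𝓞 K) ∈ v.asIdeal) :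
    v.asIdeal.ramificationIdx ℤ = 2 ∧ v.valuation K (1 - ω) = WithZero.exp (-1 : ℤ) := by
  -- `v(3) = exp(-e)`
  have hv3 : v.valuation K (((3 : ℤ)) : K) = WithZero.exp (-(v.asIdeal.ramificationIdx ℤ : ℤ)) := by
    have h := intValuation_intCast_prime_pow_mul v Nat.prime_three h3v 1 (d' := 1) (by norm_num)
    rw [← map_intCast (algebraMap (𝓞 K) K), HeightOneSpectrum.valuation_of_algebraMap]
    convert h using 2
    · push_cast; ring
    · push_cast; ring
  -- `(1 - ω)² = -3ω`, so `v(1-ω)² = v(3)`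
  have hsq : (1 - ω) ^ 2 = -(((3 : ℤ) : K) * ω) := by push_cast; linear_combination hω
  have hvsq : v.valuation K (1 - ω) ^ 2 = v.valuation K (((3 : ℤ)) : K) := by
    rw [← map_pow, hsq, Valuation.map_neg, map_mul, JZero.valuation_omega_eq_one hω v, mul_one]
  -- `e ≤ 2`
  have hℓ0 : (3 : ℤ) ≠ 0 := by norm_num
  haveI hmax : (Ideal.span {(3 : ℤ)}).IsMaximal :=
    ((Ideal.span_singleton_prime hℓ0).mpr (by norm_num)).isMaximal
      (by rw [ne_eq, Ideal.span_singleton_eq_bot]; exact hℓ0)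
  haveI : v.asIdeal.LiesOver (Ideal.span {(3 : ℤ)}) :=
    liesOver_span_of_natCast_mem_asIdeal Nat.prime_three v h3v
  have hle : v.asIdeal.ramificationIdx ℤ ≤ 2 := by
    rw [← h2, ← Ideal.ramificationIdx'_eq_ramificationIdx (Ideal.span {(3 : ℤ)}) v.asIdeal
      (by rw [ne_eq, Ideal.span_singleton_eq_bot]; exact hℓ0)]
    exact Ideal.ramificationIdx_le_finrank (R := ℤ) (S := 𝓞 K) (K := ℚ) (L := K) v.asIdeal
  -- `v(1 - ω) = exp m`
  have hne : (1 - ω : K) ≠ 0 := by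
    intro h
    have : ω = 1 := by linear_combination -h
    rw [this] at hω; norm_num at hω
  obtain ⟨m, hm⟩ : ∃ m : ℤ, v.valuation K (1 - ω) = WithZero.exp m :=
    ⟨WithZero.log (v.valuation K (1 - ω)),
      (WithZero.exp_log ((Valuation.ne_zero_iff _).mpr hne)).symm⟩
  rw [hm, hv3, ← WithZero.exp_nsmul, nsmul_eq_mul, WithZero.exp_inj] at hvsq
  -- `2m = -e`, `1 ≤ e ≤ 2` ⇒ `e = 2`, `m = -1`
  have hpos : v.asIdeal.ramificationIdx ℤ ≠ 0 := by
    rw [← Ideal.ramificationIdx'_eq_ramificationIdx (Ideal.span {(3 : ℤ)}) v.asIdeal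
      (by rw [ne_eq, Ideal.span_singleton_eq_bot]; exact hℓ0)]
    exact Ideal.IsDedekindDomain.ramificationIdx'_ne_zero_of_liesOver v.asIdeal
      (by rw [ne_eq, Ideal.span_singleton_eq_bot]; exact hℓ0)
  have he2 : v.asIdeal.ramificationIdx ℤ = 2 := by omega
  refine ⟨he2, ?_⟩
  rw [hm]
  congr 1
  rw [he2] at hvsq
  push_cast at hvsq
  omega

/-- `K_v`-form of `ord_v(1 − ω) = 1` at `v ∣ 3`. [cite: NeukirchANT1999, Ch. I §10 (3 is totally ramified in ℚ(ζ₃))] -/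
theorem JZero.valued_one_sub_omega_adicCompletion (hω : ω ^ 2 + ω + 1 = 0) (h2 : Module.finrank ℚ K = 2)
    (v : HeightOneSpectrum (𝓞 K)) (h3v : ((3 : ℕ) : 𝓞 K) ∈ v.asIdeal) :
    Valued.v (algebraMap K (v.adicCompletion K) (1 - ω)) = WithZero.exp (-1 : ℤ) :=
  (HeightOneSpectrum.valuedAdicCompletion_eq_valuation' v (1 - ω)).trans
    (JZero.ramificationIdx_eq_two_and_valuation_one_sub_omega hω h2 v h3v).2

/-- In `ℤₘ₀`, an element `< 1` is `≤ exp(−1)`. [folklore] -/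
private theorem WithZero.le_exp_neg_one_of_lt_one {x : WithZero (Multiplicative ℤ)} (hx : x < 1) :
    x ≤ WithZero.exp (-1 : ℤ) := by
  rcases eq_or_ne x 0 with rfl | hx0
  · exact zero_le
  · rw [← WithZero.exp_log hx0] at hx ⊢
    rw [← WithZero.exp_zero, WithZero.exp_lt_exp] at hx
    exact WithZero.exp_le_exp.mpr (by omega)

/-- **The cube-root obstruction at the ramified place `v ∣ 3` of `ℚ(ω)`**: an integer `c` with
`3 ∥ (c − 1)` (`3 ∣ c − 1`, `9 ∤ c − 1`) is NOT a cube in `K_v`.  Proof: if `y³ = c` then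
`(y − 1)(y − ω)(y − ω²) = y³ − 1 = c − 1` has `v`-order `e(v|3) · 1 = 2`; but `y` is a unit and the three
factors differ by associates of `1 − ω` (order `1`): if `ord_v(y − 1) = 0` all three factors are units
(order `0 ≠ 2`), if `ord_v(y − 1) ≥ 1` all three have order `≥ 1` (total `≥ 3 ≠ 2`).  (Elementary; this
replaces the residue-field computation «unit cubes are `≡ ±1 (mod 9)`».)
[cite: NeukirchANT1999, Ch. II §5, Prop. (5.3) and Ch. I §10 (units and ramification at 3 in ℚ(ζ₃))] -/
theorem JZero.pow_three_ne_intCast_adicCompletion_of_three_dvd_sub_one (hω : ω ^ 2 + ω + 1 = 0)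
    (h2 : Module.finrank ℚ K = 2) (v : HeightOneSpectrum (𝓞 K)) (h3v : ((3 : ℕ) : 𝓞 K) ∈ v.asIdeal)
    {c : ℤ} (hc3 : (3 : ℤ) ∣ c - 1) (hc9 : ¬ (9 : ℤ) ∣ c - 1) (y : v.adicCompletion K) :
    y ^ 3 ≠ (c : v.adicCompletion K) := by
  intro hy
  -- `w = ω ∈ K_v`, `w² + w + 1 = 0`
  have hw2 : (algebraMap K (v.adicCompletion K) ω) ^ 2 + algebraMap K (v.adicCompletion K) ω + 1 = 0 := by
    rw [← map_pow, ← map_add, ← map_one (algebraMap K (v.adicCompletion K)), ← map_add, hω, map_zero]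
  generalize hw : algebraMap K (v.adicCompletion K) ω = w at hw2
  have hw3 : w ^ 3 = 1 := by linear_combination (w - 1) * hw2
  -- `|1 - w| = exp(-1)`, `|w| = 1`, `|1 - w²| = exp(-1)`
  have h1w : Valued.v (1 - w) = WithZero.exp (-1 : ℤ) := by
    rw [← hw, ← map_one (algebraMap K (v.adicCompletion K)), ← map_sub]
    exact JZero.valued_one_sub_omega_adicCompletion hω h2 v h3v
  have hvw : Valued.v w = 1 := by
    have h := congrArg Valued.v hw3
    rw [map_pow, map_one] at h
    exact (pow_eq_one_iff.mp h).resolve_right (by norm_num)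
  have h1w2 : Valued.v (1 - w ^ 2) = WithZero.exp (-1 : ℤ) := by
    have : (1 - w ^ 2) = (1 - w) * (-w ^ 2) := by linear_combination (1 - w) * hw2
    rw [this, map_mul, Valuation.map_neg, map_pow, hvw, one_pow, mul_one, h1w]
  -- `|c - 1| = exp(-2)`
  obtain ⟨m, hm⟩ := hc3
  have hm3 : ¬ (3 : ℤ) ∣ m := fun ⟨k, hk⟩ ↦ hc9 ⟨k, by rw [hm, hk]; ring⟩
  have he := (JZero.ramificationIdx_eq_two_and_valuation_one_sub_omega hω h2 v h3v).1
  have hc1 : Valued.v ((c : v.adicCompletion K) - 1) = WithZero.exp (-2 : ℤ) := by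
    have h := valued_intCast_prime_pow_mul_adicCompletion v Nat.prime_three h3v 1 hm3
    rw [he, pow_one] at h
    have hcast : ((c : v.adicCompletion K) - 1) = (((3 : ℤ) * m : ℤ) : v.adicCompletion K) := by
      have hc : (c : ℤ) = 3 * m + 1 := by linarith
      rw [hc]; push_cast; ring
    rw [hcast]
    exact_mod_cast h
  -- the identity `(y - 1)(y - w)(y - w²) = y³ - 1 = c - 1`
  have hprod : (y - 1) * (y - w) * (y - w ^ 2) = (c : v.adicCompletion K) - 1 := by
    rw [← hy]; linear_combination (y - 1) * (w - 1 - y) * hw2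
  have hvprod : Valued.v (y - 1) * Valued.v (y - w) * Valued.v (y - w ^ 2) =
      WithZero.exp (-2 : ℤ) := by
    rw [← map_mul, ← map_mul, hprod, hc1]
  -- `y` is a unit: `|c| = 1`
  have hc0 : ¬ (3 : ℤ) ∣ c := fun ⟨k, hk⟩ ↦ by omega
  have hvc : Valued.v (c : v.adicCompletion K) = 1 :=
    valued_intCast_adicCompletion_eq_one Nat.prime_three v h3v hc0
  have hvy : Valued.v y = 1 := by
    have h := congrArg Valued.v hy
    rw [map_pow, hvc] at h
    exact (pow_eq_one_iff.mp h).resolve_right (by norm_num)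
  have hy1 : Valued.v (y - 1) ≤ 1 := by
    refine (Valuation.map_sub Valued.v y 1).trans ?_
    rw [hvy, Valuation.map_one, max_self]
  have hlt1 : WithZero.exp (-1 : ℤ) < (1 : WithZero (Multiplicative ℤ)) := by
    rw [← WithZero.exp_zero, WithZero.exp_lt_exp]; norm_num
  rcases hy1.lt_or_eq with hlt | heq
  · -- `ord_v(y - 1) ≥ 1`: all three factors have order `≥ 1`, total `≥ 3`
    have ha : Valued.v (y - 1) ≤ WithZero.exp (-1 : ℤ) := WithZero.le_exp_neg_one_of_lt_one hlt
    have hb : Valued.v (y - w) ≤ WithZero.exp (-1 : ℤ) := by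
      have : (y - w) = (y - 1) + (1 - w) := by ring
      rw [this]
      exact (Valuation.map_add Valued.v _ _).trans (max_le ha h1w.le)
    have hc' : Valued.v (y - w ^ 2) ≤ WithZero.exp (-1 : ℤ) := by
      have : (y - w ^ 2) = (y - 1) + (1 - w ^ 2) := by ring
      rw [this]
      exact (Valuation.map_add Valued.v _ _).trans (max_le ha h1w2.le)
    have hle : Valued.v (y - 1) * Valued.v (y - w) * Valued.v (y - w ^ 2) ≤
        WithZero.exp (-1 : ℤ) * WithZero.exp (-1 : ℤ) * WithZero.exp (-1 : ℤ) :=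
      mul_le_mul' (mul_le_mul' ha hb) hc'
    rw [hvprod, ← WithZero.exp_add, ← WithZero.exp_add, WithZero.exp_le_exp] at hle
    norm_num at hle
  · -- `ord_v(y - 1) = 0`: all three factors are units, total `0`
    have hb : Valued.v (y - w) = 1 := by
      have : (y - w) = (y - 1) + (1 - w) := by ring
      rw [this, Valuation.map_add_eq_of_lt_left Valued.v (by rw [heq, h1w]; exact hlt1), heq]
    have hc' : Valued.v (y - w ^ 2) = 1 := by
      have : (y - w ^ 2) = (y - 1) + (1 - w ^ 2) := by ring
      rw [this, Valuation.map_add_eq_of_lt_left Valued.v (by rw [heq, h1w2]; exact hlt1), heq]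
    rw [heq, hb, hc', one_mul, one_mul, ← WithZero.exp_zero, WithZero.exp_inj] at hvprod
    norm_num at hvprod


/-! ### §2b `3` is TOTALLY ramified in `ℚ(ω)`: `(3) = v²`, `(9) = v⁴` for the place `v ∋ 3` -/

/-- Arithmetic: `a² · b = 9` with `a ≠ 1` forces `b = 1` (`a = 3`). [folklore] -/
private theorem eq_one_of_sq_mul_eq {a b : ℕ} (ha : a ≠ 1) (h : a ^ 2 * b = 9) : b = 1 := by
  have hb : b ≠ 0 := by rintro rfl; simp at h
  have ha3 : a ≤ 3 := by
    by_contra hlt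
    have h4 : 4 ≤ a := by omega
    have : 4 ^ 2 * 1 ≤ a ^ 2 * b := Nat.mul_le_mul (Nat.pow_le_pow_left h4 2) (Nat.one_le_iff_ne_zero.mpr hb)
    omega
  interval_cases a <;> omega

/-- Norm bookkeeping: a principal ideal `(x) ⊆ v^n` EQUALS `v^n` as soon as `N(v)^n · b = N((x))` forces `b = 1`
(`(x) = v^n · J`, `N(J) = 1`, `J = 𝓞_K`). [folklore] -/
private theorem span_eq_pow_of_le_of_absNorm {x : 𝓞 K} {n : ℕ} (v : HeightOneSpectrum (𝓞 K))
    (hle : (Ideal.span {x} : Ideal (𝓞 K)) ≤ v.asIdeal ^ n)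
    (harith : ∀ b : ℕ, Ideal.absNorm v.asIdeal ^ n * b = Ideal.absNorm (Ideal.span {x} : Ideal (𝓞 K)) → b = 1) :
    (Ideal.span {x} : Ideal (𝓞 K)) = v.asIdeal ^ n := by
  obtain ⟨J, hJ⟩ := Ideal.dvd_iff_le.mpr hle
  have hN := congrArg Ideal.absNorm hJ
  rw [map_mul, map_pow] at hN
  have hJ1 : Ideal.absNorm J = 1 := harith _ hN.symm
  rw [Ideal.absNorm_eq_one_iff] at hJ1
  rw [hJ, hJ1, Ideal.mul_top]

/-- **`(3) = v²` in `K = ℚ(ω)`** (`ω² + ω + 1 = 0`, `[K : ℚ] = 2`) for the place `v ∋ 3`: `3` is TOTALLY ramified,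
`v = (1 - ω)` is the ONLY prime above `3` (`e(v|3) = 2 = [K : ℚ]`; norms: `N(3) = 9 = N(v)²`).
[cite: NeukirchANT1999, Ch. I §10 (3 = −ω²(1−ω)² is totally ramified in ℚ(ζ₃))] -/
theorem JZero.span_three_eq_asIdeal_sq (hω : ω ^ 2 + ω + 1 = 0) (h2 : Module.finrank ℚ K = 2)
    (v : HeightOneSpectrum (𝓞 K)) (h3v : ((3 : ℕ) : 𝓞 K) ∈ v.asIdeal) :
    (Ideal.span {((3 : ℕ) : 𝓞 K)} : Ideal (𝓞 K)) = v.asIdeal ^ 2 := by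
  have he := (JZero.ramificationIdx_eq_two_and_valuation_one_sub_omega hω h2 v h3v).1
  -- `3 ∈ v²`
  have hval := intValuation_intCast_prime_pow_mul v Nat.prime_three h3v 1 (d' := 1) (by norm_num)
  rw [he] at hval
  have hmem : ((3 : ℕ) : 𝓞 K) ∈ v.asIdeal ^ 2 := by
    rw [← HeightOneSpectrum.intValuation_le_pow_iff_mem]
    convert hval.le using 2
    push_cast; ring
  refine span_eq_pow_of_le_of_absNorm v ((Ideal.span_singleton_le_iff_mem _).mpr hmem) fun b hb => ?_
  have hN3 : Ideal.absNorm (Ideal.span {((3 : ℕ) : 𝓞 K)} : Ideal (𝓞 K)) = 9 := by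
    rw [Ideal.absNorm_span_singleton]
    have : ((3 : ℕ) : 𝓞 K) = algebraMap ℤ (𝓞 K) 3 := by simp
    rw [this, Algebra.norm_algebraMap, NumberField.RingOfIntegers.rank, h2]
    norm_num
  rw [hN3] at hb
  have hv1 : Ideal.absNorm v.asIdeal ≠ 1 := by
    rw [Ne, Ideal.absNorm_eq_one_iff]; exact v.isPrime.ne_top
  exact eq_one_of_sq_mul_eq hv1 hb

/-- **`(9) = v⁴` in `K = ℚ(ω)`** for the place `v ∋ 3` — the shape `Ideal.span {(q : 𝓞 K)} = v.asIdeal ^ t` (`q = 9`,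
`t = 4`) consumed by the ramified-prime ring class theorems
(`RingClassField.forall_apply_eq_iff_exists_mem_inertia_of_span_eq_pow`,
`exists_mem_ringClassGalOver_apply_emb_eq_of_mem_inertia_of_span_eq_pow`: the primes of `K[m]` above `(1 - ω)` are
totally ramified in `K[9m]`, `3 ∤ m`). [cite: NeukirchANT1999, Ch. I §10] [cite: HuShuYin2019, §2 Prop. 2.4 (1)] -/
theorem JZero.span_nine_eq_asIdeal_pow_four (hω : ω ^ 2 + ω + 1 = 0) (h2 : Module.finrank ℚ K = 2)
    (v : HeightOneSpectrum (𝓞 K)) (h3v : ((3 : ℕ) : 𝓞 K) ∈ v.asIdeal) :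
    (Ideal.span {((9 : ℕ) : 𝓞 K)} : Ideal (𝓞 K)) = v.asIdeal ^ 4 := by
  have h9 : ((9 : ℕ) : 𝓞 K) = ((3 : ℕ) : 𝓞 K) * ((3 : ℕ) : 𝓞 K) := by push_cast; norm_num
  rw [h9, ← Ideal.span_singleton_mul_span_singleton, JZero.span_three_eq_asIdeal_sq hω h2 v h3v, ← pow_add]

end OmegaField

end Literature.NumberTheory.EllipticCurves

/-! ## §3 The Sylvester pair: `2p²` and `18p⁴` are not cubes in `K_v` at `v ∣ p` and `v ∣ 3` -/

namespace Literature.NumberTheory.EllipticCurves.HuShuYin2019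

open Literature.NumberTheory.EllipticCurves Literature.NumberTheory.NumberFields
  Literature.NumberTheory.GaloisRepresentations

section NoCubeRoots

variable {K : Type} [Field K] [NumberField K] {ω : K}

/-- **`2p²` is not a cube in `K_v` for `v ∣ p`** (`K = ℚ(ω)`, `p ≠ 2, 3` prime: `e(v|p) = 1`,
`ord_v(2p²) = 2 ∉ 3ℤ`) — so `B = E_p : y² = x³ − 432p²` has no `K_v`-rational point of order `2`.
[cite: HuShuYin2019, §2 (the curves E_n)] [cite: NeukirchANT1999, Ch. II §4] -/
theorem pow_three_ne_two_mul_sq_adicCompletion_of_mem (hω : ω ^ 2 + ω + 1 = 0)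
    (h2 : Module.finrank ℚ K = 2) {p : ℕ} (hp : p.Prime) (hp2 : p ≠ 2) (hp3 : p ≠ 3)
    (v : HeightOneSpectrum (𝓞 K)) (hpv : ((p : ℕ) : 𝓞 K) ∈ v.asIdeal) (t : v.adicCompletion K) :
    t ^ 3 ≠ 2 * ((p : ℚ) : v.adicCompletion K) ^ 2 := by
  have he := JZero.ramificationIdx_eq_one_of_prime_ne_three hω h2 hp hp3 v hpv
  have hd' : ¬ (p : ℤ) ∣ 2 := fun h ↦ hp2 ((Nat.prime_dvd_prime_iff_eq hp Nat.prime_two).mp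
    (by exact_mod_cast h))
  intro ht
  refine pow_three_ne_intCast_adicCompletion_of_not_dvd v hp hpv (a := 2)
    (by rw [he]; decide) hd' t ?_
  rw [ht]; push_cast; ring

/-- **`18p⁴ = 2·(3p²)²` is not a cube in `K_v` for `v ∣ p`** (`ord_v(18p⁴) = 4 ∉ 3ℤ`) — so
`A = E_{3p²} : y² = x³ − 432·9p⁴` has no `K_v`-rational point of order `2`.
[cite: HuShuYin2019, §2 (the curves E_n)] [cite: NeukirchANT1999, Ch. II §4] -/
theorem pow_three_ne_two_mul_sq_three_mul_sq_adicCompletion_of_mem (hω : ω ^ 2 + ω + 1 = 0)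
    (h2 : Module.finrank ℚ K = 2) {p : ℕ} (hp : p.Prime) (hp2 : p ≠ 2) (hp3 : p ≠ 3)
    (v : HeightOneSpectrum (𝓞 K)) (hpv : ((p : ℕ) : 𝓞 K) ∈ v.asIdeal) (t : v.adicCompletion K) :
    t ^ 3 ≠ 2 * ((3 * (p : ℚ) ^ 2 : ℚ) : v.adicCompletion K) ^ 2 := by
  have he := JZero.ramificationIdx_eq_one_of_prime_ne_three hω h2 hp hp3 v hpv
  have hd' : ¬ (p : ℤ) ∣ 18 := by
    intro h
    have h' : p ∣ 2 * 3 ^ 2 := by exact_mod_cast h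
    rcases (Nat.Prime.dvd_mul hp).mp h' with h2' | h3'
    · exact hp2 ((Nat.prime_dvd_prime_iff_eq hp Nat.prime_two).mp h2')
    · exact hp3 ((Nat.prime_dvd_prime_iff_eq hp Nat.prime_three).mp (hp.dvd_of_dvd_pow h3'))
  haveI : CharZero (v.adicCompletion K) := charZero_adicCompletion v
  intro ht
  refine pow_three_ne_intCast_adicCompletion_of_not_dvd v hp hpv (a := 4)
    (by rw [he]; decide) hd' t ?_
  rw [ht]; push_cast; ring

/-- **`18p⁴` is not a cube in `K_v` for `v ∣ 3`** (`e(v|3) = 2`, `ord_v(18p⁴) = ord_v(9) = 4 ∉ 3ℤ`,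
any prime `p ≠ 3`) — so `A = E_{3p²}` has no `K_v`-rational point of order `2` at the place above `3`.
[cite: HuShuYin2019, §2 (the curves E_n)] [cite: NeukirchANT1999, Ch. II §4] -/
theorem pow_three_ne_two_mul_sq_three_mul_sq_adicCompletion_of_three_mem (hω : ω ^ 2 + ω + 1 = 0)
    (h2 : Module.finrank ℚ K = 2) {p : ℕ} (hp : p.Prime) (hp3 : p ≠ 3)
    (v : HeightOneSpectrum (𝓞 K)) (h3v : ((3 : ℕ) : 𝓞 K) ∈ v.asIdeal) (t : v.adicCompletion K) :
    t ^ 3 ≠ 2 * ((3 * (p : ℚ) ^ 2 : ℚ) : v.adicCompletion K) ^ 2 := by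
  have he := (JZero.ramificationIdx_eq_two_and_valuation_one_sub_omega hω h2 v h3v).1
  have hd' : ¬ (3 : ℤ) ∣ 2 * (p : ℤ) ^ 4 := by
    intro h
    have h' : 3 ∣ 2 * p ^ 4 := by exact_mod_cast h
    rcases (Nat.Prime.dvd_mul Nat.prime_three).mp h' with h2' | h3'
    · norm_num at h2'
    · exact hp3 ((Nat.prime_dvd_prime_iff_eq Nat.prime_three hp).mp
        (Nat.prime_three.dvd_of_dvd_pow h3')).symm
  haveI : CharZero (v.adicCompletion K) := charZero_adicCompletion v
  intro ht
  refine pow_three_ne_intCast_adicCompletion_of_not_dvd v Nat.prime_three h3v (a := 2)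
    (by rw [he]; decide) hd' t ?_
  rw [ht]; push_cast; ring

/-- **`2p²` is not a cube in `K_v` for `v ∣ 3` when `p ≡ 4 (mod 9)`** (then `−2p² ≡ 4 (mod 9)`, i.e.
`3 ∥ (−2p² − 1)`, and `JZero.pow_three_ne_intCast_adicCompletion_of_three_dvd_sub_one` applies to
`c = −2p²`, `y = −t`) — so `B = E_p` has no `K_v`-rational point of order `2` at the place above `3`.
(False for `p ≡ 7 (mod 9)`: there `2p² ∈ ℚ₃^{×3}`.) [cite: HuShuYin2019, §2 (the curves E_n)]
[cite: NeukirchANT1999, Ch. II §5, Prop. (5.3)] -/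
theorem pow_three_ne_two_mul_sq_adicCompletion_of_three_mem (hω : ω ^ 2 + ω + 1 = 0)
    (h2 : Module.finrank ℚ K = 2) {p : ℕ} (hp9 : p % 9 = 4)
    (v : HeightOneSpectrum (𝓞 K)) (h3v : ((3 : ℕ) : 𝓞 K) ∈ v.asIdeal) (t : v.adicCompletion K) :
    t ^ 3 ≠ 2 * ((p : ℚ) : v.adicCompletion K) ^ 2 := by
  intro ht
  have hp9' : (p : ℤ) % 9 = 4 := by exact_mod_cast hp9
  have hc3 : (3 : ℤ) ∣ -2 * (p : ℤ) ^ 2 - 1 := by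
    have : (-2 * (p : ℤ) ^ 2 - 1) % 3 = 0 := by
      have h9 : (p : ℤ) = 9 * ((p : ℤ) / 9) + 4 := by omega
      rw [h9]; ring_nf; omega
    exact Int.dvd_of_emod_eq_zero this
  have hc9 : ¬ (9 : ℤ) ∣ -2 * (p : ℤ) ^ 2 - 1 := by
    intro h
    have h9 : (p : ℤ) = 9 * ((p : ℤ) / 9) + 4 := by omega
    have : (-2 * (p : ℤ) ^ 2 - 1) % 9 = 0 := Int.emod_eq_zero_of_dvd h
    rw [h9] at this; ring_nf at this; omega
  refine JZero.pow_three_ne_intCast_adicCompletion_of_three_dvd_sub_one hω h2 v h3v hc3 hc9 (-t) ?_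
  rw [neg_pow, ht]; push_cast; ring

end NoCubeRoots

/-! ## §4 No `K_v`-rational `2`-power torsion, and the EMPTY local conditions at `v ∣ 3p` -/

section LocalConditions

variable {K : Type} [Field K] [NumberField K] {ω : K}

/-- `(E_n)_K` base-changed to a `K`-field `F` is `E_n` base-changed to `F` (transitivity of base
change along `ℚ → K → F`; coefficientwise `map_ratCast`). [folklore] -/
private theorem baseChange_baseChange_cubeSumCurve (n : ℚ) (F : Type) [Field F] [Algebra K F]
    [CharZero F] : ((cubeSumCurve n).baseChange K).baseChange F = (cubeSumCurve n).baseChange F := by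
  change ((⟨0, 0, 0, 0, -432 * n ^ 2⟩ : WeierstrassCurve ℚ).map (algebraMap ℚ K)).map
      (algebraMap K F) = (⟨0, 0, 0, 0, -432 * n ^ 2⟩ : WeierstrassCurve ℚ).map (algebraMap ℚ F)
  ext <;> simp [WeierstrassCurve.map, map_ofNat]

/-- `(E_n)_F` is an elliptic curve for `n ≠ 0` over a field of characteristic `0`
(`Δ = −432·(432n²)² ≠ 0`). [cite: HuShuYin2019, §2] -/
theorem isElliptic_cubeSumCurve_baseChange (F : Type) [Field F] [Algebra ℚ F] [CharZero F] {n : ℚ}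
    (hn : n ≠ 0) : ((cubeSumCurve n).baseChange F).IsElliptic := by
  refine ⟨?_⟩
  rw [isUnit_iff_ne_zero]
  change ((⟨0, 0, 0, 0, -432 * n ^ 2⟩ : WeierstrassCurve ℚ).map (algebraMap ℚ F)).Δ ≠ 0
  simp only [WeierstrassCurve.map_Δ]
  rw [map_ne_zero_iff _ (algebraMap ℚ F).injective]
  simp only [WeierstrassCurve.Δ, WeierstrassCurve.b₂, WeierstrassCurve.b₄, WeierstrassCurve.b₆,
    WeierstrassCurve.b₈]
  have : n ^ 2 ≠ 0 := pow_ne_zero 2 hn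
  intro h
  apply this
  nlinarith [sq_nonneg n, h]

/-- **`X(K_v)[2^k] = 0` from «`2n²` is not a cube in `K_v`»**, for `X = (E_n)_K` and a `K`-field `F`
(tree `cubeSumCurve_eq_zero_of_two_pow_smul_eq_zero`, transported along `((E_n)_K)_F = (E_n)_F`).
[cite: SilvermanTate2015, §2.1, Thm. 2.1(a)] [cite: HuShuYin2019, §2] -/
theorem cubeSumCurve_baseChange_eq_zero_of_two_pow_smul_eq_zero (n : ℚ) (F : Type) [Field F]
    [Algebra K F] [CharZero F] (hF : ∀ t : F, t ^ 3 ≠ 2 * (n : F) ^ 2) (k : ℕ)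
    (P : (((cubeSumCurve n).baseChange K).baseChange F).toAffine.Point) (hP : 2 ^ k • P = 0) :
    P = 0 := by
  have key : ∀ (V : WeierstrassCurve F), V = (cubeSumCurve n).baseChange F →
      ∀ Q : V.toAffine.Point, 2 ^ k • Q = 0 → Q = 0 := by
    intro V hV
    subst hV
    exact fun Q hQ ↦ cubeSumCurve_eq_zero_of_two_pow_smul_eq_zero n hF k Q hQ
  exact key _ (baseChange_baseChange_cubeSumCurve n F) P hP

/-- **The (L1) local conditions at `v ∣ p` for `B = E_p` are EMPTY**: for `p ≠ 2, 3` prime,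
`p ≡ 1 (mod 3)` not needed, `K = ℚ(ω)` and `v ∣ p`, EVERY class of `H¹(K, B_K[2^k])` satisfies the
Selmer local condition and the strict local condition at `v` (`B(K_v)[2] = 0` and the tree's
`mem_selmerLocalKer_and_mem_torsionLocalKer_adicCompletion_pow`). [cite: HuShuYin2019, §2]
[cite: MilneADT2006, Ch. I, Cor. 2.3 and Thm. 2.8] -/
theorem mem_localKers_cubeSumCurve_prime_of_mem (hω : ω ^ 2 + ω + 1 = 0)
    (h2 : Module.finrank ℚ K = 2) {p : ℕ} (hp : p.Prime) (hp2 : p ≠ 2) (hp3 : p ≠ 3)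
    (v : HeightOneSpectrum (𝓞 K)) (hpv : ((p : ℕ) : 𝓞 K) ∈ v.asIdeal) (k : ℕ)
    (c : galH1Torsion ((cubeSumCurve (p : ℚ)).baseChange K) ((2 ^ k : ℕ) : ℤ)) :
    c ∈ selmerLocalKer ((cubeSumCurve (p : ℚ)).baseChange K) (v.adicCompletion K) ((2 ^ k : ℕ) : ℤ) ∧
      c ∈ ((cubeSumCurve (p : ℚ)).baseChange K).torsionLocalKer (v.adicCompletion K)
        ((2 ^ k : ℕ) : ℤ) := by
  haveI := isElliptic_cubeSumCurve_baseChange K (n := (p : ℚ)) (by exact_mod_cast hp.ne_zero)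
  haveI : CharZero (v.adicCompletion K) := charZero_adicCompletion v
  have h2v : ((2 : ℕ) : 𝓞 K) ∉ v.asIdeal := by
    intro h
    have h' : ((2 : ℤ) : 𝓞 K) ∈ v.asIdeal := by exact_mod_cast h
    rw [intCast_mem_asIdeal_iff_of_natCast_mem hp v hpv] at h'
    exact hp2 ((Nat.prime_dvd_prime_iff_eq hp Nat.prime_two).mp (by exact_mod_cast h'))
  refine WeierstrassCurve.mem_selmerLocalKer_and_mem_torsionLocalKer_adicCompletion_pow _ v h2v
    (fun P hP ↦ ?_) k c
  exact cubeSumCurve_baseChange_eq_zero_of_two_pow_smul_eq_zero (p : ℚ) (v.adicCompletion K)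
    (pow_three_ne_two_mul_sq_adicCompletion_of_mem hω h2 hp hp2 hp3 v hpv) 1 P (by rwa [pow_one])

/-- **The (L1) local conditions at `v ∣ p` for `A = E_{3p²}` are EMPTY** (`A(K_v)[2] = 0`).
[cite: HuShuYin2019, §2] [cite: MilneADT2006, Ch. I, Cor. 2.3 and Thm. 2.8] -/
theorem mem_localKers_cubeSumCurve_three_mul_sq_of_mem (hω : ω ^ 2 + ω + 1 = 0)
    (h2 : Module.finrank ℚ K = 2) {p : ℕ} (hp : p.Prime) (hp2 : p ≠ 2) (hp3 : p ≠ 3)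
    (v : HeightOneSpectrum (𝓞 K)) (hpv : ((p : ℕ) : 𝓞 K) ∈ v.asIdeal) (k : ℕ)
    (c : galH1Torsion ((cubeSumCurve (3 * (p : ℚ) ^ 2)).baseChange K) ((2 ^ k : ℕ) : ℤ)) :
    c ∈ selmerLocalKer ((cubeSumCurve (3 * (p : ℚ) ^ 2)).baseChange K) (v.adicCompletion K)
        ((2 ^ k : ℕ) : ℤ) ∧
      c ∈ ((cubeSumCurve (3 * (p : ℚ) ^ 2)).baseChange K).torsionLocalKer (v.adicCompletion K)
        ((2 ^ k : ℕ) : ℤ) := by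
  haveI := isElliptic_cubeSumCurve_baseChange K (n := 3 * (p : ℚ) ^ 2)
    (by have := hp.ne_zero; positivity)
  haveI : CharZero (v.adicCompletion K) := charZero_adicCompletion v
  have h2v : ((2 : ℕ) : 𝓞 K) ∉ v.asIdeal := by
    intro h
    have h' : ((2 : ℤ) : 𝓞 K) ∈ v.asIdeal := by exact_mod_cast h
    rw [intCast_mem_asIdeal_iff_of_natCast_mem hp v hpv] at h'
    exact hp2 ((Nat.prime_dvd_prime_iff_eq hp Nat.prime_two).mp (by exact_mod_cast h'))
  refine WeierstrassCurve.mem_selmerLocalKer_and_mem_torsionLocalKer_adicCompletion_pow _ v h2v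
    (fun P hP ↦ ?_) k c
  exact cubeSumCurve_baseChange_eq_zero_of_two_pow_smul_eq_zero (3 * (p : ℚ) ^ 2) (v.adicCompletion K)
    (pow_three_ne_two_mul_sq_three_mul_sq_adicCompletion_of_mem hω h2 hp hp2 hp3 v hpv) 1 P
    (by rwa [pow_one])

/-- **The (L1) local conditions at `v ∣ 3` for `A = E_{3p²}` are EMPTY** (`A(K_v)[2] = 0`: `ord_v(18p⁴) = 4`
is not a multiple of `3`). [cite: HuShuYin2019, §2] [cite: MilneADT2006, Ch. I, Cor. 2.3 and Thm. 2.8] -/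
theorem mem_localKers_cubeSumCurve_three_mul_sq_of_three_mem (hω : ω ^ 2 + ω + 1 = 0)
    (h2 : Module.finrank ℚ K = 2) {p : ℕ} (hp : p.Prime) (hp3 : p ≠ 3)
    (v : HeightOneSpectrum (𝓞 K)) (h3v : ((3 : ℕ) : 𝓞 K) ∈ v.asIdeal) (k : ℕ)
    (c : galH1Torsion ((cubeSumCurve (3 * (p : ℚ) ^ 2)).baseChange K) ((2 ^ k : ℕ) : ℤ)) :
    c ∈ selmerLocalKer ((cubeSumCurve (3 * (p : ℚ) ^ 2)).baseChange K) (v.adicCompletion K)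
        ((2 ^ k : ℕ) : ℤ) ∧
      c ∈ ((cubeSumCurve (3 * (p : ℚ) ^ 2)).baseChange K).torsionLocalKer (v.adicCompletion K)
        ((2 ^ k : ℕ) : ℤ) := by
  haveI := isElliptic_cubeSumCurve_baseChange K (n := 3 * (p : ℚ) ^ 2)
    (by have := hp.ne_zero; positivity)
  haveI : CharZero (v.adicCompletion K) := charZero_adicCompletion v
  have h2v : ((2 : ℕ) : 𝓞 K) ∉ v.asIdeal := by
    intro h
    have h' : ((2 : ℤ) : 𝓞 K) ∈ v.asIdeal := by exact_mod_cast h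
    rw [intCast_mem_asIdeal_iff_of_natCast_mem Nat.prime_three v h3v] at h'
    norm_num at h'
  refine WeierstrassCurve.mem_selmerLocalKer_and_mem_torsionLocalKer_adicCompletion_pow _ v h2v
    (fun P hP ↦ ?_) k c
  exact cubeSumCurve_baseChange_eq_zero_of_two_pow_smul_eq_zero (3 * (p : ℚ) ^ 2) (v.adicCompletion K)
    (pow_three_ne_two_mul_sq_three_mul_sq_adicCompletion_of_three_mem hω h2 hp hp3 v h3v) 1 P
    (by rwa [pow_one])

/-- **The (L1) local conditions at `v ∣ 3` for `B = E_p`, `p ≡ 4 (mod 9)`, are EMPTY**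
(`B(K_v)[2] = 0` by the cube-root obstruction at the ramified place). [cite: HuShuYin2019, §2]
[cite: MilneADT2006, Ch. I, Cor. 2.3 and Thm. 2.8] -/
theorem mem_localKers_cubeSumCurve_prime_of_three_mem (hω : ω ^ 2 + ω + 1 = 0)
    (h2 : Module.finrank ℚ K = 2) {p : ℕ} (hp : p.Prime) (hp9 : p % 9 = 4)
    (v : HeightOneSpectrum (𝓞 K)) (h3v : ((3 : ℕ) : 𝓞 K) ∈ v.asIdeal) (k : ℕ)
    (c : galH1Torsion ((cubeSumCurve (p : ℚ)).baseChange K) ((2 ^ k : ℕ) : ℤ)) :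
    c ∈ selmerLocalKer ((cubeSumCurve (p : ℚ)).baseChange K) (v.adicCompletion K) ((2 ^ k : ℕ) : ℤ) ∧
      c ∈ ((cubeSumCurve (p : ℚ)).baseChange K).torsionLocalKer (v.adicCompletion K)
        ((2 ^ k : ℕ) : ℤ) := by
  haveI := isElliptic_cubeSumCurve_baseChange K (n := (p : ℚ)) (by exact_mod_cast hp.ne_zero)
  haveI : CharZero (v.adicCompletion K) := charZero_adicCompletion v
  have h2v : ((2 : ℕ) : 𝓞 K) ∉ v.asIdeal := by
    intro h
    have h' : ((2 : ℤ) : 𝓞 K) ∈ v.asIdeal := by exact_mod_cast h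
    rw [intCast_mem_asIdeal_iff_of_natCast_mem Nat.prime_three v h3v] at h'
    norm_num at h'
  refine WeierstrassCurve.mem_selmerLocalKer_and_mem_torsionLocalKer_adicCompletion_pow _ v h2v
    (fun P hP ↦ ?_) k c
  exact cubeSumCurve_baseChange_eq_zero_of_two_pow_smul_eq_zero (p : ℚ) (v.adicCompletion K)
    (pow_three_ne_two_mul_sq_adicCompletion_of_three_mem hω h2 hp9 v h3v) 1 P (by rwa [pow_one])

end LocalConditions

end Literature.NumberTheory.EllipticCurves.HuShuYin2019
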